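import Summits.BirchSwinnertonDyer.Rank1Residual.X11b.KolyvaginSqueezeRecordsKitThree
import HarnessLib

/-!
# BSD rank-≤1 residual cell, rank ONE at `p = 3` with `#Ш_an = 9` (cells (3,'X11b') / (3,'X4') / (3,'X7') /
(3,'X8')): `BSD(E,3)` PER PAIR by the
# Kolyvagin SQUEEZE — Heegner-index certificate `ord₃ [E(K):ℤy_K] = 1` (upper half, two engines) × two-engine EXACT
`3`-descent `dim Sel³(E/ℚ) = 3`
# (lower half, Cassels–Tate) — records 06 of 11 (unit `b2b-bsdres-x11c` GEN 38 «KOLY3-SQUEEZE»,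
prover-b2b-bsdres-x11c-g38-0, 2026-08-28)

HONEST FRAMING (cell `b2b-bsdres-*`, verbatim): prove what is provable now; shrink each hard class to its core with
data; no claim beyond
stated classes; COMBINATION classes deleted from PUBLISHED theorems only, CONSTRUCTION-shaped remainder typed; this
is not "finishing BSD".
X11b (and X11 ∧ r = 1 ∧ p = 3, R6.2), X4, X7, X8 stay CONSTRUCTION-SHAPED as classes; PER PAIR; nothing booked by
this file (referee A
books); NO named fact introduced; NO definition; class labels of other cells' classes (X4: n1011 / additive-p*,
X7/X8: x10b /
additive-p3 / bsd-ssimc) are untouched — these are SERVICE records on their cells, nothing of theirs superseded.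

WHAT. On referee A2's state `pub-bsdpct-r5-g15/scratchA2_state_after_kurx4am_add1c5_onA2R1030_fold.pkl`
(45ab5fdd2800f5ab) there
are 77 rank-ONE residue classes with an open cell `(3, X)`, `X ∈ {X11b, X4, X7, X8}`, whose curve `…1` has
`#Ш_an = 9`, `ρ̄_{E,3}`
onto (no Cremona galrep 3-code) and `3 ∤ #E(ℚ)_tors·∏c_ℓ` (population
`HOME/b2b-bsdres-x11c/gen38/squeeze/pop/pop38b.json`). On such
a cell neither a Kolyvagin `3 ∤ [E(K):ℤy_K]` certificate (GEN 35 KOLY3) nor a `dim Sel³ = rank` certificate (T-SEL3)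
can exist: BSD
predicts `Ш(E)[3^∞] ≅ (ℤ/3)²`. THE SQUEEZE (unit `b2b-bsdres-sha-2`'s
`Rank1Residual.bsdp_of_kolyvagin_index_of_casselsTate_of_pow_dvd`,
`X4/KolyvaginSqueeze.lean`; ANY odd `p`, analytic rank `≤ 1`, NO hypothesis on the reduction of `E` at `p`): UPPER
half
`ord₃ #Ш(E/ℚ) ≤ 2` from Kolyvagin as printed by McCallum 1991 §1 (`ord₃ #Ш(E/K) ≤ 2·ord₃ [E(K):ℤy_K]`, named facts
`kolyvagin`,
`Kolyvagin1990_padicValNat_card_sha_le`, registry A20, referee C2 ROUND 326 «p = 3 allowed as printed») with the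
odd-part splitting
`#Ш(E/K)[3^∞] = #Ш(E/ℚ)[3^∞]·#Ш(E^{(d_K)}/ℚ)[3^∞]` (JSW 2017 §7.4.1, tree theorem) and the certificate
`ord₃ [E(K):ℤy_K] ≤ 1`;
LOWER half `9 ∣ #Ш(E/ℚ)` from ONE descent line `#Sel^(3)(E/ℚ) = 27` (`rank = r_an = 1` by GZK, `3 ∤ #E(ℚ)_tors` by the
irreducibility of `E[3]` ⇒ `Ш(E)[3] ≠ 0`, `Typed.exists_sha_torsion_of_pow_rank_lt_card_selmerGroup`) and
Cassels–Tate squareness;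
with `#Ш_an = 9`: Miller's `BSD(E,3)`. KERNEL (per pair, through the unit's GEN 38 kit
`X11b.bsdp_three_of_kolyvaginIndexLeOne_of_card_selmer_of_irr_of_order`,
`X11b/KolyvaginSqueezeRecordsKitThree.lean`, every numeric
hypothesis a `decide` / `norm_num` goal): global minimality of Cremona's model by prover B's factored Kraus
criterion on the COMPLETE
factorisation of `|Δ|`; `ρ̄_{E,3}` ONTO from two Frobenius witnesses (Serre 1972 Prop. 15: an irreducible Frobenius
and one of order 3,
schema point counts). DISPLAYED binders per record (evidence, certified outside Lean — exactly the KOLY3 tuple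
referee A booked flag-free
at R958 / R961, plus `hCT`, the twist datum and `hSel`): `hGZK`, `hCT`, `hKo`, `hB`; the Heegner datum `K = ℚ(√D)`
(`hK`, `hH`),
`P = y_K` (`hP`, `hnt`) with `hI : ord₃ [E(K):ℤP] ≤ 1`; the twist datum `Wd` = Cremona's / PARI's minimal model of
`E^{(D)}` with
`hWd` (a `ℚ`-isomorphism class statement) and `hrD : r_an(Wd) ≤ 1` (the engines: root number `+1`, `L(E^D,1) ≠ 0`);
`hr : r_an = 1`,
`hq`/`hv : #Ш_an = 9` (Cremona); `hSel : #Sel^(3)(E/ℚ) = 3^3`.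
ENGINES (all BYTE-IDENTICAL, sha256 in each run folder's `outputs/inputs.sha256`; run folders
`HOME/b2b-bsdres-x11c/gen38/squeeze/harvest/<job>/`
with the daemon's `MANIFEST.json`): Heegner index — ENGINE 1 = the unit's gen-3 `main.py` (sha256 `69e29ec7…` = X9
g7 `jobD1b.py`;
PARI `ellL1`, `ellheight`, period lattice; `m² = 4·ĥ(y_K)/ĥ(x)` with `x` Cremona's generator saturated; kit j303974,
NDISC 12 /
DBOUND 6000: per pair the FIRST Heegner field `K = ℚ(√D)` (every `q ∣ N` split, `3 ∤ D`) with `ord₃ m = 1` is the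
certificate
field; earlier fields with `ord₃ m ≥ 2` are listed per row) ‖ ENGINE 2 = `run_cert.py` (sha256 `1b54bb20…`, stdlib
only, X9 gen 7:
recomputes `a_ℓ`, `L'(E,1)`, `L(E^D,1)`, the period lattice, `ĥ(x)` by Tate's series, `ĥ(y_K)` by
Gross–Zagier–Zhang, `m`,
`ord₃ m` — EQUAL —, plus a `3`-saturation witness prime for `x` and an `E(K)[3] = 0` witness prime; kit j304100) ‖
STAGE C =
additive-p1's `twistvals` (sha256 `e501b988…`; kit j304101): `N_{E^D}`, root number, `L(E^D,1)`, `Ω`, `#tors`, `∏c`,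
`#Ш_an(E^D)`
(BSD-consistency of the twist side: `3 ∤ #tors(E^D)·#Ш_an(E^D)`, as the squeeze predicts `Ш(E^D)[3] = 0`). Descent —
ENGINE C =
unit `b2b-bsdres-x11b`'s `desc3lib.gp` (sha256 `c4fb20b7…`, exact-element Schaefer–Stoll, one orbit = surjective
image; kit j305968) ‖
ENGINE E = unit `b2b-bsdres-x10b`'s INDEPENDENT `desc3full_e2.py` (sha256 `dfa51aff…`; kit j305969): per row the
descent grade EE / EL / LE / LL
(E = `EXACT(bnfcertify1+3sat)` equality, L = three independent EXACTLY verified Selmer elements = the unconditional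
lower bound `dim ≥ 3`,
equality modulo the class group); every row `dim Sel^(3)(E/ℚ) ≥ 3` on BOTH engines (expected `= rank + 2`),
Cremona's generator located in
the Selmer group; the kit consumes only `3³ ≤ #Sel^(3)(E/ℚ)` (`…_of_le_card_selmer_…`, the kit file's second
theorem). Tables:
`HOME/b2b-bsdres-x11c/gen38/squeeze/harvest/rows38b.json`, `gen38/squeeze/ROWS38B-TABLE.md`. THIS FILE (records 06):
7 pairs — `298134c1` (X4), `350919k1` (X4), `371682b1` (X4), `376065h1` (X4), `377397a1` (X4), `395784w1` (X4),
`405936q1` (X4).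

References: McCallum 1991 §1 [McCallumLMS1991]; Gross 1991 [GrossLMS1991]; Kolyvagin 1990
[KolyvaginEulerSystems1990]; Gross–Zagier
1986 [GrossZagier1986]; Jetchev–Skinner–Wan 2017 §7.4 [JetchevSkinnerWan2017]; Serre 1972 §2.4 Prop. 15 [Serre1972];
Silverman AEC
X.4.2, X.4.14, VII.3.1 [SilvermanAEC2009]; Kraus 1989 [Kraus1989]; Schaefer–Stoll 2004 [SchaeferStoll2004]; Miller
2011 Def. 1.1, Thm.
4.1 [Miller2011LMS]; Cremona's tables [Cremona2006].
-/

set_option autoImplicit false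

noncomputable section

open scoped Classical

open WeierstrassCurve Literature.NumberTheory.EllipticCurves
  Literature.NumberTheory.EllipticCurves.Rank1Residual
  Literature.NumberTheory.EllipticCurves.Rank1Residual.Typed
  Literature.NumberTheory.EllipticCurves.Rank1Residual.X11RankOneCertificates
  Summit.BirchSwinnertonDyer.BirchSwinnertonDyer.Rank1Residual.IntModel
  Summit.BirchSwinnertonDyer.BirchSwinnertonDyer.Rank1Residual.X11RankOne

namespace Summit.BirchSwinnertonDyer.Rank1Residual.X11b

/-- **`BSD(E,3)` for `298134c1`** (`N = 298134 = 2·3³·5521`; additive at `3` (`v₃(N) = 3`), `E[3]` irreducible (class X4); `#tors = 1`, `∏c = 2`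
(`3 ∤ #tors·∏c`), `r_an = 1`, **`#Ш_an = 9`**, galrep none (no 3-code: `ρ̄_{E,3}` onto), generator `(207, 2657)`; residue class of A2 state
`45ab5fdd`, (3,'X4') the SOLE open cell). HEEGNER INDEX (upper half): fields with `ord₃ m ≥ 2` before the certificate field: none. `D = -23` (23
prime; every prime of `N` split, `3 ∤ D`): **`m = 12`, `ord₃ m = 1`** (`ρ = ĥ(y_K)/ĥ(x) = 36.00…`; `L′(E,1) = 5.90649940…`,
`L(E^D,1) = 0.44533732…`, `ĥ(x) = 1.24587426…`) — engine 1 (j303974) = engine 2 (j304100; EQUAL `m = 12`, `ord₃ m = 1`, dev. ≤ 1.2e-14, checks true;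
`3`-saturation witness prime [13, 12], `E(K)[3] = 0` witness prime [5, 'inert', 35]); twist `E^D` (stage C j304101): minimal model
`[1, -1, 0, -2123505, 4713436957]`, `N_{E^D} = 157712886`, root number `+1`, `L(E^D,1) = 0.44533732… ≠ 0` ⇒ `r_an(E^D) = 0`; `#tors = 1`, `∏c = 4`,
`#Ш_an(E^D) = 1` — `3 ∤ #tors·#Ш_an(E^D)` (BSD-shape: the squeeze forces `Ш(E^D)[3] = 0`). DESCENT (lower half): engine C x11b `desc3lib` (j305968):
octic `A` disc `-2633448157189380795312`, `S = [2, 3, 5, 7, 5521]`, `Cl(A) = [9, [3, 3]]`, `bnfcertify(A,1) = 1`, `18` generators 3-saturated,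
`dim H¹(ℚ,E[3];S) = 4`, **`dim Sel^(3)(E/ℚ) = 3`** (expected 3: MATCH), generator in `Sel`, mode `GRH(3sat)`, cert `certs/cert_298134c1.gp`
`20057e151d42a55e…`; engine E x10b `desc3full_e2` (j305969): `Cl = [9, [3, 3]]`, `Cl_S = [1, []]`, `18` generators, `bnfcertify = -2`, `dim H¹ = 4`,
**`dim Sel^(3)(E/ℚ) = 3`**, mode `LOWERBOUND` — TWO independent implementations, descent grade **LL** (E = equality EXACT, L = three independent
EXACTLY verified Selmer elements = the unconditional LOWER bound `dim ≥ 3`; the kit uses only `3³ ≤ #Sel`) ⇒ `27 ≤ #Sel^(3)(E/ℚ)`, `Ш(E)[3] ≠ 0` —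
the lower half. Witnesses mod `3` `(ℓ,#Ẽ(𝔽_ℓ))` = `(5,5)` (`a = 1`: `X² − aX + ℓ` root-free over `𝔽₃`), `(13,12)` (`ℓ ≡ 1`, `a = 2 ≡ 2 (mod 3)`,
`9 ∤ #Ẽ`). `|Δ| = ∏` over `[(2, 13), (3, 5), (5521, 2)]`. Kernel: minimality, onto, `3 ∣ #Ш` from `hSel`; displayed: `hGZK hCT hKo hB`, Heegner
datum (`hK hH hP hnt hI`), twist datum (`Wd hWd hrD`), `hr hq hv`, `hSel : 3³ ≤ #Sel^(3)(E/ℚ)`.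
[cite: McCallumLMS1991, §1 Theorem (Kolyvagin), p. 296] [cite: SilvermanAEC2009, Thm. X.4.2(a) and Thm. X.4.14] [cite: Serre1972, §2.4 Prop. 15] [cite: Cremona2006, Table 1 (label 298134c1)] -/
theorem bsdp_q298134c1_3 (hGZK : rank_eq_analyticRank_of_analyticRank_le_one)
    (hCT : exists_casselsTate_pairing (K := ℚ)) (W : WeierstrassCurve ℚ)
    (hW : W = ⟨1, -1, 0, -4014, -386348⟩) {N : ℕ} [NeZero N] {K : Type} [Field K] [NumberField K]
    (hKo : kolyvagin N W K) (hB : Kolyvagin1990_padicValNat_card_sha_le N W K) (hK : IsImaginaryQuadratic K)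
    (hH : SatisfiesHeegnerHypothesis N K) {P : (W.baseChange K).toAffine.Point} (hP : IsHeegnerPoint N W K P)
    (hnt : ¬ IsOfFinAddOrder P) (hI : padicValNat 3 (AddSubgroup.zmultiples P).index ≤ 1)
    (Wd : WeierstrassCurve ℚ) [Wd.IsElliptic]
    (hWd : ∃ C : VariableChange ℚ, C • W.quadraticTwist ((NumberField.discr K : ℤ) : ℚ) = Wd)
    (hrD : Wd.analyticRank ≤ 1) (hr : W.analyticRank = 1)
    {q : ℚ} (hq : shaAn W = (q : ℂ)) (hv : padicValRat 3 q = 2)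
    (hSel : 3 ^ 3 ≤ Nat.card (W.selmerGroup (3 : ℤ))) : BSDp W 3 :=
  bsdp_three_of_kolyvaginIndexLeOne_of_le_card_selmer_of_irr_of_order 1 (-1) 0 (-4014) (-386348)
    (Supersingular.isGloballyMinimal_of_krausCriterion₃_factored 1 (-1) 0 (-4014) (-386348) [(2, 13), (3, 5), (5521, 2)] (by decide +kernel)
      (by intro t ht; fin_cases ht <;> norm_num) (by decide +kernel))
    5 13 (by norm_num) (by norm_num) (by decide) (by decide) (by decide) (by decide) (by decide +kernel) (by decide +kernel)
    (n₁ := 5) (n₂ := 12) (by decide +kernel) (by decide +kernel) (by decide) (by decide) (by decide) (by decide)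
    hGZK hCT W hW hKo hB hK hH hP hnt hI Wd hWd hrD hr hq hv hSel

/-- **`BSD(E,3)` for `350919k1`** (`N = 350919 = 3³·41·317`; additive at `3` (`v₃(N) = 3`), `E[3]` irreducible (class X4); `#tors = 1`, `∏c = 1`
(`3 ∤ #tors·∏c`), `r_an = 1`, **`#Ш_an = 9`**, galrep none (no 3-code: `ρ̄_{E,3}` onto), generator `(250, -121)`; residue class of A2 state
`45ab5fdd`, (3,'X4') the SOLE open cell). HEEGNER INDEX (upper half): fields with `ord₃ m ≥ 2` before the certificate field: `-23`: `m = 36`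
(`ord₃ = 2`). `D = -59` (59 prime; every prime of `N` split, `3 ∤ D`): **`m = 60`, `ord₃ m = 1`** (`ρ = ĥ(y_K)/ĥ(x) = 899.99…`;
`L′(E,1) = 11.49878094…`, `L(E^D,1) = 2.98753837…`, `ĥ(x) = 1.05782335…`) — engine 1 (j303974) = engine 2 (j304100; EQUAL `m = 60`, `ord₃ m = 1`,
dev. ≤ 4.9e-15, checks true; `3`-saturation witness prime [19, 24], `E(K)[3] = 0` witness prime [5, 'split', 5]); twist `E^D` (stage C j304101):
minimal model `[1, -1, 1, -652145117, -6409932222148]`, `N_{E^D} = 1221549039`, root number `+1`, `L(E^D,1) = 2.98753837… ≠ 0` ⇒ `r_an(E^D) = 0`;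
`#tors = 1`, `∏c = 2`, `#Ш_an(E^D) = 100` — `3 ∤ #tors·#Ш_an(E^D)` (BSD-shape: the squeeze forces `Ш(E^D)[3] = 0`). DESCENT (lower half): engine C
x11b `desc3lib` (j305968): octic `A` disc `-5054826779886821960907`, `S = [3, 41, 317]`, `Cl(A) = [18, [6, 3]]`, `bnfcertify(A,1) = 1`, `13`
generators 3-saturated, `dim H¹(ℚ,E[3];S) = 3`, **`dim Sel^(3)(E/ℚ) = 3`** (expected 3: MATCH), generator in `Sel`, mode `GRH(3sat)`, cert
`certs/cert_350919k1.gp` `75f11f072a2e8007…`; engine E x10b `desc3full_e2` (j305969): `Cl = [18, [6, 3]]`, `Cl_S = [1, []]`, `13` generators,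
`bnfcertify = -2`, `dim H¹ = 3`, **`dim Sel^(3)(E/ℚ) = 3`**, mode `LOWERBOUND` — TWO independent implementations, descent grade **LL** (E = equality
EXACT, L = three independent EXACTLY verified Selmer elements = the unconditional LOWER bound `dim ≥ 3`; the kit uses only `3³ ≤ #Sel`) ⇒
`27 ≤ #Sel^(3)(E/ℚ)`, `Ш(E)[3] ≠ 0` — the lower half. Witnesses mod `3` `(ℓ,#Ẽ(𝔽_ℓ))` = `(5,5)` (`a = 1`: `X² − aX + ℓ` root-free over `𝔽₃`),
`(19,24)` (`ℓ ≡ 1`, `a = -4 ≡ 2 (mod 3)`, `9 ∤ #Ẽ`). `|Δ| = ∏` over `[(3, 5), (41, 1), (317, 1)]`. Kernel: minimality, onto, `3 ∣ #Ш` from `hSel`;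
displayed: `hGZK hCT hKo hB`, Heegner datum (`hK hH hP hnt hI`), twist datum (`Wd hWd hrD`), `hr hq hv`, `hSel : 3³ ≤ #Sel^(3)(E/ℚ)`.
[cite: McCallumLMS1991, §1 Theorem (Kolyvagin), p. 296] [cite: SilvermanAEC2009, Thm. X.4.2(a) and Thm. X.4.14] [cite: Serre1972, §2.4 Prop. 15] [cite: Cremona2006, Table 1 (label 350919k1)] -/
theorem bsdp_q350919k1_3 (hGZK : rank_eq_analyticRank_of_analyticRank_le_one)
    (hCT : exists_casselsTate_pairing (K := ℚ)) (W : WeierstrassCurve ℚ)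
    (hW : W = ⟨1, -1, 0, -187344, 31257891⟩) {N : ℕ} [NeZero N] {K : Type} [Field K] [NumberField K]
    (hKo : kolyvagin N W K) (hB : Kolyvagin1990_padicValNat_card_sha_le N W K) (hK : IsImaginaryQuadratic K)
    (hH : SatisfiesHeegnerHypothesis N K) {P : (W.baseChange K).toAffine.Point} (hP : IsHeegnerPoint N W K P)
    (hnt : ¬ IsOfFinAddOrder P) (hI : padicValNat 3 (AddSubgroup.zmultiples P).index ≤ 1)
    (Wd : WeierstrassCurve ℚ) [Wd.IsElliptic]
    (hWd : ∃ C : VariableChange ℚ, C • W.quadraticTwist ((NumberField.discr K : ℤ) : ℚ) = Wd)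
    (hrD : Wd.analyticRank ≤ 1) (hr : W.analyticRank = 1)
    {q : ℚ} (hq : shaAn W = (q : ℂ)) (hv : padicValRat 3 q = 2)
    (hSel : 3 ^ 3 ≤ Nat.card (W.selmerGroup (3 : ℤ))) : BSDp W 3 :=
  bsdp_three_of_kolyvaginIndexLeOne_of_le_card_selmer_of_irr_of_order 1 (-1) 0 (-187344) 31257891
    (Supersingular.isGloballyMinimal_of_krausCriterion₃_factored 1 (-1) 0 (-187344) 31257891 [(3, 5), (41, 1), (317, 1)] (by decide +kernel)
      (by intro t ht; fin_cases ht <;> norm_num) (by decide +kernel))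
    5 19 (by norm_num) (by norm_num) (by decide) (by decide) (by decide) (by decide) (by decide +kernel) (by decide +kernel)
    (n₁ := 5) (n₂ := 24) (by decide +kernel) (by decide +kernel) (by decide) (by decide) (by decide) (by decide)
    hGZK hCT W hW hKo hB hK hH hP hnt hI Wd hWd hrD hr hq hv hSel

/-- **`BSD(E,3)` for `371682b1`** (`N = 371682 = 2·3³·6883`; additive at `3` (`v₃(N) = 3`), `E[3]` irreducible (class X4); `#tors = 1`, `∏c = 2`
(`3 ∤ #tors·∏c`), `r_an = 1`, **`#Ш_an = 9`**, galrep none (no 3-code: `ρ̄_{E,3}` onto), generator `(251, 3316)`; residue class of A2 state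
`45ab5fdd`, (3,'X4') the SOLE open cell). HEEGNER INDEX (upper half): fields with `ord₃ m ≥ 2` before the certificate field: none. `D = -23` (23
prime; every prime of `N` split, `3 ∤ D`): **`m = 24`, `ord₃ m = 1`** (`ρ = ĥ(y_K)/ĥ(x) = 144.00…`; `L′(E,1) = 5.36127929…`,
`L(E^D,1) = 2.14454262…`, `ĥ(x) = 1.34411386…`) — engine 1 (j303974) = engine 2 (j304100; EQUAL `m = 24`, `ord₃ m = 1`, dev. ≤ 4.1e-15, checks true;
`3`-saturation witness prime [29, 24], `E(K)[3] = 0` witness prime [5, 'inert', 35]); twist `E^D` (stage C j304101): minimal model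
`[1, -1, 0, -6935289, 7724682701]`, `N_{E^D} = 196619778`, root number `+1`, `L(E^D,1) = 2.14454262… ≠ 0` ⇒ `r_an(E^D) = 0`; `#tors = 1`, `∏c = 4`,
`#Ш_an(E^D) = 4` — `3 ∤ #tors·#Ш_an(E^D)` (BSD-shape: the squeeze forces `Ш(E^D)[3] = 0`). DESCENT (lower half): engine C x11b `desc3lib` (j305968):
octic `A` disc `-78538001140599437232`, `S = [2, 3, 6883]`, `Cl(A) = [3, [3]]`, `bnfcertify(A,1) = 1`, `12` generators 3-saturated,
`dim H¹(ℚ,E[3];S) = 3`, **`dim Sel^(3)(E/ℚ) = 3`** (expected 3: MATCH), generator in `Sel`, mode `GRH(3sat)`, cert `certs/cert_371682b1.gp`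
`c037936583363464…`; engine E x10b `desc3full_e2` (j305969): `Cl = [3, [3]]`, `Cl_S = [1, []]`, `12` generators, `bnfcertify = -2`, `dim H¹ = 3`,
**`dim Sel^(3)(E/ℚ) = 3`**, mode `LOWERBOUND` — TWO independent implementations, descent grade **LL** (E = equality EXACT, L = three independent
EXACTLY verified Selmer elements = the unconditional LOWER bound `dim ≥ 3`; the kit uses only `3³ ≤ #Sel`) ⇒ `27 ≤ #Sel^(3)(E/ℚ)`, `Ш(E)[3] ≠ 0` —
the lower half. Witnesses mod `3` `(ℓ,#Ẽ(𝔽_ℓ))` = `(5,7)` (`a = -1`: `X² − aX + ℓ` root-free over `𝔽₃`), `(37,30)` (`ℓ ≡ 1`, `a = 8 ≡ 2 (mod 3)`,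
`9 ∤ #Ẽ`). `|Δ| = ∏` over `[(2, 5), (3, 9), (6883, 2)]`. Kernel: minimality, onto, `3 ∣ #Ш` from `hSel`; displayed: `hGZK hCT hKo hB`, Heegner datum
(`hK hH hP hnt hI`), twist datum (`Wd hWd hrD`), `hr hq hv`, `hSel : 3³ ≤ #Sel^(3)(E/ℚ)`.
[cite: McCallumLMS1991, §1 Theorem (Kolyvagin), p. 296] [cite: SilvermanAEC2009, Thm. X.4.2(a) and Thm. X.4.14] [cite: Serre1972, §2.4 Prop. 15] [cite: Cremona2006, Table 1 (label 371682b1)] -/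
theorem bsdp_q371682b1_3 (hGZK : rank_eq_analyticRank_of_analyticRank_le_one)
    (hCT : exists_casselsTate_pairing (K := ℚ)) (W : WeierstrassCurve ℚ)
    (hW : W = ⟨1, -1, 0, -13110, -631468⟩) {N : ℕ} [NeZero N] {K : Type} [Field K] [NumberField K]
    (hKo : kolyvagin N W K) (hB : Kolyvagin1990_padicValNat_card_sha_le N W K) (hK : IsImaginaryQuadratic K)
    (hH : SatisfiesHeegnerHypothesis N K) {P : (W.baseChange K).toAffine.Point} (hP : IsHeegnerPoint N W K P)
    (hnt : ¬ IsOfFinAddOrder P) (hI : padicValNat 3 (AddSubgroup.zmultiples P).index ≤ 1)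
    (Wd : WeierstrassCurve ℚ) [Wd.IsElliptic]
    (hWd : ∃ C : VariableChange ℚ, C • W.quadraticTwist ((NumberField.discr K : ℤ) : ℚ) = Wd)
    (hrD : Wd.analyticRank ≤ 1) (hr : W.analyticRank = 1)
    {q : ℚ} (hq : shaAn W = (q : ℂ)) (hv : padicValRat 3 q = 2)
    (hSel : 3 ^ 3 ≤ Nat.card (W.selmerGroup (3 : ℤ))) : BSDp W 3 :=
  bsdp_three_of_kolyvaginIndexLeOne_of_le_card_selmer_of_irr_of_order 1 (-1) 0 (-13110) (-631468)
    (Supersingular.isGloballyMinimal_of_krausCriterion₃_factored 1 (-1) 0 (-13110) (-631468) [(2, 5), (3, 9), (6883, 2)] (by decide +kernel)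
      (by intro t ht; fin_cases ht <;> norm_num) (by decide +kernel))
    5 37 (by norm_num) (by norm_num) (by decide) (by decide) (by decide) (by decide) (by decide +kernel) (by decide +kernel)
    (n₁ := 7) (n₂ := 30) (by decide +kernel) (by decide +kernel) (by decide) (by decide) (by decide) (by decide)
    hGZK hCT W hW hKo hB hK hH hP hnt hI Wd hWd hrD hr hq hv hSel

/-- **`BSD(E,3)` for `376065h1`** (`N = 376065 = 3²·5·61·137`; additive at `3` (`v₃(N) = 2`), `E[3]` irreducible (class X4); `#tors = 2`, `∏c = 8`
(`3 ∤ #tors·∏c`), `r_an = 1`, **`#Ш_an = 9`**, galrep 2B (no 3-code: `ρ̄_{E,3}` onto), generator `(560, 10944)`; residue class of A2 state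
`45ab5fdd`, (3,'X4') the SOLE open cell). HEEGNER INDEX (upper half): fields with `ord₃ m ≥ 2` before the certificate field: none. `D = -56` (56 =
2³·7; every prime of `N` split, `3 ∤ D`): **`m = 24`, `ord₃ m = 1`** (`ρ = ĥ(y_K)/ĥ(x) = 144.00…`; `L′(E,1) = 11.73733589…`,
`L(E^D,1) = 0.91259609…`, `ĥ(x) = 4.52211674…`) — engine 1 (j303974) = engine 2 (j304100; EQUAL `m = 24`, `ord₃ m = 1`, dev. ≤ 9.9e-15, checks true;
`3`-saturation witness prime [29, 30], `E(K)[3] = 0` witness prime [11, 'inert', 140]); twist `E^D` (stage C j304101): minimal model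
`[0, 0, 0, -230355468, 1455187153392]`, `N_{E^D} = 1179339840`, root number `+1`, `L(E^D,1) = 0.91259609… ≠ 0` ⇒ `r_an(E^D) = 0`; `#tors = 2`,
`∏c = 64`, `#Ш_an(E^D) = 1` — `3 ∤ #tors·#Ш_an(E^D)` (BSD-shape: the squeeze forces `Ш(E^D)[3] = 0`). DESCENT (lower half): engine C x11b `desc3lib`
(j305968): octic `A` disc `-6666999292684884616875`, `S = [3, 5, 61, 137]`, `Cl(A) = [3, [3]]`, `bnfcertify(A,1) = 1`, `15` generators 3-saturated,
`dim H¹(ℚ,E[3];S) = 3`, **`dim Sel^(3)(E/ℚ) = 3`** (expected 3: MATCH), generator in `Sel`, mode `GRH(3sat)`, cert `certs/cert_376065h1.gp`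
`4367c5088fccc320…`; engine E x10b `desc3full_e2` (j305969): `Cl = [3, [3]]`, `Cl_S = [1, []]`, `15` generators, `bnfcertify = -2`, `dim H¹ = 3`,
**`dim Sel^(3)(E/ℚ) = 3`**, mode `LOWERBOUND` — TWO independent implementations, descent grade **LL** (E = equality EXACT, L = three independent
EXACTLY verified Selmer elements = the unconditional LOWER bound `dim ≥ 3`; the kit uses only `3³ ≤ #Sel`) ⇒ `27 ≤ #Sel^(3)(E/ℚ)`, `Ш(E)[3] ≠ 0` —
the lower half. Witnesses mod `3` `(ℓ,#Ẽ(𝔽_ℓ))` = `(11,10)` (`a = 2`: `X² − aX + ℓ` root-free over `𝔽₃`), `(67,66)` (`ℓ ≡ 1`, `a = 2 ≡ 2 (mod 3)`,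
`9 ∤ #Ẽ`). `|Δ| = ∏` over `[(3, 9), (5, 5), (61, 2), (137, 2)]`. Kernel: minimality, onto, `3 ∣ #Ш` from `hSel`; displayed: `hGZK hCT hKo hB`,
Heegner datum (`hK hH hP hnt hI`), twist datum (`Wd hWd hrD`), `hr hq hv`, `hSel : 3³ ≤ #Sel^(3)(E/ℚ)`.
[cite: McCallumLMS1991, §1 Theorem (Kolyvagin), p. 296] [cite: SilvermanAEC2009, Thm. X.4.2(a) and Thm. X.4.14] [cite: Serre1972, §2.4 Prop. 15] [cite: Cremona2006, Table 1 (label 376065h1)] -/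
theorem bsdp_q376065h1_3 (hGZK : rank_eq_analyticRank_of_analyticRank_le_one)
    (hCT : exists_casselsTate_pairing (K := ℚ)) (W : WeierstrassCurve ℚ)
    (hW : W = ⟨1, -1, 0, -73455, -8267824⟩) {N : ℕ} [NeZero N] {K : Type} [Field K] [NumberField K]
    (hKo : kolyvagin N W K) (hB : Kolyvagin1990_padicValNat_card_sha_le N W K) (hK : IsImaginaryQuadratic K)
    (hH : SatisfiesHeegnerHypothesis N K) {P : (W.baseChange K).toAffine.Point} (hP : IsHeegnerPoint N W K P)
    (hnt : ¬ IsOfFinAddOrder P) (hI : padicValNat 3 (AddSubgroup.zmultiples P).index ≤ 1)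
    (Wd : WeierstrassCurve ℚ) [Wd.IsElliptic]
    (hWd : ∃ C : VariableChange ℚ, C • W.quadraticTwist ((NumberField.discr K : ℤ) : ℚ) = Wd)
    (hrD : Wd.analyticRank ≤ 1) (hr : W.analyticRank = 1)
    {q : ℚ} (hq : shaAn W = (q : ℂ)) (hv : padicValRat 3 q = 2)
    (hSel : 3 ^ 3 ≤ Nat.card (W.selmerGroup (3 : ℤ))) : BSDp W 3 :=
  bsdp_three_of_kolyvaginIndexLeOne_of_le_card_selmer_of_irr_of_order 1 (-1) 0 (-73455) (-8267824)
    (Supersingular.isGloballyMinimal_of_krausCriterion₃_factored 1 (-1) 0 (-73455) (-8267824) [(3, 9), (5, 5), (61, 2), (137, 2)] (by decide +kernel)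
      (by intro t ht; fin_cases ht <;> norm_num) (by decide +kernel))
    11 67 (by norm_num) (by norm_num) (by decide) (by decide) (by decide) (by decide) (by decide +kernel) (by decide +kernel)
    (n₁ := 10) (n₂ := 66) (by decide +kernel) (by decide +kernel) (by decide) (by decide) (by decide) (by decide)
    hGZK hCT W hW hKo hB hK hH hP hnt hI Wd hWd hrD hr hq hv hSel

/-- **`BSD(E,3)` for `377397a1`** (`N = 377397 = 3²·19·2207`; additive at `3` (`v₃(N) = 2`), `E[3]` irreducible (class X4); `#tors = 2`, `∏c = 4`
(`3 ∤ #tors·∏c`), `r_an = 1`, **`#Ш_an = 9`**, galrep 2B (no 3-code: `ρ̄_{E,3}` onto), generator `(-80, 80)`; residue class of A2 state `45ab5fdd`,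
(3,'X4') the SOLE open cell). HEEGNER INDEX (upper half): fields with `ord₃ m ≥ 2` before the certificate field: none. `D = -116` (116 = 2²·29;
every prime of `N` split, `3 ∤ D`): **`m = 48`, `ord₃ m = 1`** (`ρ = ĥ(y_K)/ĥ(x) = 576.00…`; `L′(E,1) = 7.11387462…`, `L(E^D,1) = 4.97191077…`,
`ĥ(x) = 1.96552695…`) — engine 1 (j303974) = engine 2 (j304100; EQUAL `m = 48`, `ord₃ m = 1`, dev. ≤ 3.6e-15, checks true; `3`-saturation witness
prime [11, 6], `E(K)[3] = 0` witness prime [5, 'split', 4]); twist `E^D` (stage C j304101): minimal model `[0, 0, 0, -267420339, 1680161185458]`,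
`N_{E^D} = 5078254032`, root number `+1`, `L(E^D,1) = 4.97191077… ≠ 0` ⇒ `r_an(E^D) = 0`; `#tors = 2`, `∏c = 64`, `#Ш_an(E^D) = 4` —
`3 ∤ #tors·#Ш_an(E^D)` (BSD-shape: the squeeze forces `Ш(E^D)[3] = 0`). DESCENT (lower half): engine C x11b `desc3lib` (j305968): octic `A` disc
`-6761958787147644093627`, `S = [3, 19, 2207]`, `Cl(A) = [36, [12, 3]]`, `bnfcertify(A,1) = 1`, `12` generators 3-saturated, `dim H¹(ℚ,E[3];S) = 3`,
**`dim Sel^(3)(E/ℚ) = 3`** (expected 3: MATCH), generator in `Sel`, mode `GRH(3sat)`, cert `certs/cert_377397a1.gp` `58a46b79e013461b…`; engine E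
x10b `desc3full_e2` (j305969): `Cl = [36, [12, 3]]`, `Cl_S = [4, [4]]`, `12` generators, `bnfcertify = -2`, `dim H¹ = 3`,
**`dim Sel^(3)(E/ℚ) = 3`**, mode `LOWERBOUND` — TWO independent implementations, descent grade **LL** (E = equality EXACT, L = three independent
EXACTLY verified Selmer elements = the unconditional LOWER bound `dim ≥ 3`; the kit uses only `3³ ≤ #Sel`) ⇒ `27 ≤ #Sel^(3)(E/ℚ)`, `Ш(E)[3] ≠ 0` —
the lower half. Witnesses mod `3` `(ℓ,#Ẽ(𝔽_ℓ))` = `(5,4)` (`a = 2`: `X² − aX + ℓ` root-free over `𝔽₃`), `(13,12)` (`ℓ ≡ 1`, `a = 2 ≡ 2 (mod 3)`,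
`9 ∤ #Ẽ`). `|Δ| = ∏` over `[(3, 9), (19, 1), (2207, 2)]`. Kernel: minimality, onto, `3 ∣ #Ш` from `hSel`; displayed: `hGZK hCT hKo hB`, Heegner
datum (`hK hH hP hnt hI`), twist datum (`Wd hWd hrD`), `hr hq hv`, `hSel : 3³ ≤ #Sel^(3)(E/ℚ)`.
[cite: McCallumLMS1991, §1 Theorem (Kolyvagin), p. 296] [cite: SilvermanAEC2009, Thm. X.4.2(a) and Thm. X.4.14] [cite: Serre1972, §2.4 Prop. 15] [cite: Cremona2006, Table 1 (label 377397a1)] -/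
theorem bsdp_q377397a1_3 (hGZK : rank_eq_analyticRank_of_analyticRank_le_one)
    (hCT : exists_casselsTate_pairing (K := ℚ)) (W : WeierstrassCurve ℚ)
    (hW : W = ⟨1, -1, 1, -19874, -1071440⟩) {N : ℕ} [NeZero N] {K : Type} [Field K] [NumberField K]
    (hKo : kolyvagin N W K) (hB : Kolyvagin1990_padicValNat_card_sha_le N W K) (hK : IsImaginaryQuadratic K)
    (hH : SatisfiesHeegnerHypothesis N K) {P : (W.baseChange K).toAffine.Point} (hP : IsHeegnerPoint N W K P)
    (hnt : ¬ IsOfFinAddOrder P) (hI : padicValNat 3 (AddSubgroup.zmultiples P).index ≤ 1)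
    (Wd : WeierstrassCurve ℚ) [Wd.IsElliptic]
    (hWd : ∃ C : VariableChange ℚ, C • W.quadraticTwist ((NumberField.discr K : ℤ) : ℚ) = Wd)
    (hrD : Wd.analyticRank ≤ 1) (hr : W.analyticRank = 1)
    {q : ℚ} (hq : shaAn W = (q : ℂ)) (hv : padicValRat 3 q = 2)
    (hSel : 3 ^ 3 ≤ Nat.card (W.selmerGroup (3 : ℤ))) : BSDp W 3 :=
  bsdp_three_of_kolyvaginIndexLeOne_of_le_card_selmer_of_irr_of_order 1 (-1) 1 (-19874) (-1071440)
    (Supersingular.isGloballyMinimal_of_krausCriterion₃_factored 1 (-1) 1 (-19874) (-1071440) [(3, 9), (19, 1), (2207, 2)] (by decide +kernel)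
      (by intro t ht; fin_cases ht <;> norm_num) (by decide +kernel))
    5 13 (by norm_num) (by norm_num) (by decide) (by decide) (by decide) (by decide) (by decide +kernel) (by decide +kernel)
    (n₁ := 4) (n₂ := 12) (by decide +kernel) (by decide +kernel) (by decide) (by decide) (by decide) (by decide)
    hGZK hCT W hW hKo hB hK hH hP hnt hI Wd hWd hrD hr hq hv hSel

/-- **`BSD(E,3)` for `395784w1`** (`N = 395784 = 2³·3²·23·239`; additive at `3` (`v₃(N) = 2`), `E[3]` irreducible (class X4); `#tors = 1`, `∏c = 4`
(`3 ∤ #tors·∏c`), `r_an = 1`, **`#Ш_an = 9`**, galrep none (no 3-code: `ρ̄_{E,3}` onto), generator `(936, 54)`; residue class of A2 state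
`45ab5fdd`, (3,'X4') the SOLE open cell). HEEGNER INDEX (upper half): fields with `ord₃ m ≥ 2` before the certificate field: none. `D = -143` (143 =
11·13; every prime of `N` split, `3 ∤ D`): **`m = 96`, `ord₃ m = 1`** (`ρ = ĥ(y_K)/ĥ(x) = 2304.00…`; `L′(E,1) = 8.49939882…`,
`L(E^D,1) = 0.63424502…`, `ĥ(x) = 0.39214238…`) — engine 1 (j303974) = engine 2 (j304100; EQUAL `m = 96`, `ord₃ m = 1`, dev. ≤ 4.1e-15, checks true;
`3`-saturation witness prime [19, 15], `E(K)[3] = 0` witness prime [5, 'inert', 35]); twist `E^D` (stage C j304101): minimal model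
`[0, 0, 0, -53862911388, -4811526142152444]`, `N_{E^D} = 8093387016`, root number `+1`, `L(E^D,1) = 0.63424502… ≠ 0` ⇒ `r_an(E^D) = 0`; `#tors = 1`,
`∏c = 8`, `#Ш_an(E^D) = 16` — `3 ∤ #tors·#Ш_an(E^D)` (BSD-shape: the squeeze forces `Ш(E^D)[3] = 0`). DESCENT (lower half): engine C x11b `desc3lib`
(j305968): octic `A` disc `-2044804007081573526528`, `S = [2, 3, 23, 239]`, `Cl(A) = [288, [24, 6, 2]]`, `bnfcertify(A,1) = 1`, `12` generators
3-saturated, `dim H¹(ℚ,E[3];S) = 3`, **`dim Sel^(3)(E/ℚ) = 3`** (expected 3: MATCH), generator in `Sel`, mode `GRH(3sat)`, cert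
`certs/cert_395784w1.gp` `8eeab85043e94d10…`; engine E x10b `desc3full_e2` (j305969): `Cl = [288, [24, 6, 2]]`, `Cl_S = [2, [2]]`, `12` generators,
`bnfcertify = -2`, `dim H¹ = 3`, **`dim Sel^(3)(E/ℚ) = 3`**, mode `LOWERBOUND` — TWO independent implementations, descent grade **LL** (E = equality
EXACT, L = three independent EXACTLY verified Selmer elements = the unconditional LOWER bound `dim ≥ 3`; the kit uses only `3³ ≤ #Sel`) ⇒
`27 ≤ #Sel^(3)(E/ℚ)`, `Ш(E)[3] ≠ 0` — the lower half. Witnesses mod `3` `(ℓ,#Ẽ(𝔽_ℓ))` = `(5,5)` (`a = 1`: `X² − aX + ℓ` root-free over `𝔽₃`),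
`(19,15)` (`ℓ ≡ 1`, `a = 5 ≡ 2 (mod 3)`, `9 ∤ #Ẽ`). `|Δ| = ∏` over `[(2, 8), (3, 9), (23, 1), (239, 1)]`. Kernel: minimality, onto, `3 ∣ #Ш` from
`hSel`; displayed: `hGZK hCT hKo hB`, Heegner datum (`hK hH hP hnt hI`), twist datum (`Wd hWd hrD`), `hr hq hv`, `hSel : 3³ ≤ #Sel^(3)(E/ℚ)`.
[cite: McCallumLMS1991, §1 Theorem (Kolyvagin), p. 296] [cite: SilvermanAEC2009, Thm. X.4.2(a) and Thm. X.4.14] [cite: Serre1972, §2.4 Prop. 15] [cite: Cremona2006, Table 1 (label 395784w1)] -/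
theorem bsdp_q395784w1_3 (hGZK : rank_eq_analyticRank_of_analyticRank_le_one)
    (hCT : exists_casselsTate_pairing (K := ℚ)) (W : WeierstrassCurve ℚ)
    (hW : W = ⟨0, 0, 0, -2634012, 1645412292⟩) {N : ℕ} [NeZero N] {K : Type} [Field K] [NumberField K]
    (hKo : kolyvagin N W K) (hB : Kolyvagin1990_padicValNat_card_sha_le N W K) (hK : IsImaginaryQuadratic K)
    (hH : SatisfiesHeegnerHypothesis N K) {P : (W.baseChange K).toAffine.Point} (hP : IsHeegnerPoint N W K P)
    (hnt : ¬ IsOfFinAddOrder P) (hI : padicValNat 3 (AddSubgroup.zmultiples P).index ≤ 1)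
    (Wd : WeierstrassCurve ℚ) [Wd.IsElliptic]
    (hWd : ∃ C : VariableChange ℚ, C • W.quadraticTwist ((NumberField.discr K : ℤ) : ℚ) = Wd)
    (hrD : Wd.analyticRank ≤ 1) (hr : W.analyticRank = 1)
    {q : ℚ} (hq : shaAn W = (q : ℂ)) (hv : padicValRat 3 q = 2)
    (hSel : 3 ^ 3 ≤ Nat.card (W.selmerGroup (3 : ℤ))) : BSDp W 3 :=
  bsdp_three_of_kolyvaginIndexLeOne_of_le_card_selmer_of_irr_of_order 0 0 0 (-2634012) 1645412292
    (Supersingular.isGloballyMinimal_of_krausCriterion₃_factored 0 0 0 (-2634012) 1645412292 [(2, 8), (3, 9), (23, 1), (239, 1)] (by decide +kernel)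
      (by intro t ht; fin_cases ht <;> norm_num) (by decide +kernel))
    5 19 (by norm_num) (by norm_num) (by decide) (by decide) (by decide) (by decide) (by decide +kernel) (by decide +kernel)
    (n₁ := 5) (n₂ := 15) (by decide +kernel) (by decide +kernel) (by decide) (by decide) (by decide) (by decide)
    hGZK hCT W hW hKo hB hK hH hP hnt hI Wd hWd hrD hr hq hv hSel

/-- **`BSD(E,3)` for `405936q1`** (`N = 405936 = 2⁴·3²·2819`; additive at `3` (`v₃(N) = 2`), `E[3]` irreducible (class X4); `#tors = 2`, `∏c = 4`
(`3 ∤ #tors·∏c`), `r_an = 1`, **`#Ш_an = 9`**, galrep 2B (no 3-code: `ρ̄_{E,3}` onto), generator `(125, 1260)`; residue class of A2 state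
`45ab5fdd`, (3,'X4') the SOLE open cell). HEEGNER INDEX (upper half): fields with `ord₃ m ≥ 2` before the certificate field: none. `D = -23` (23
prime; every prime of `N` split, `3 ∤ D`): **`m = 12`, `ord₃ m = 1`** (`ρ = ĥ(y_K)/ĥ(x) = 36.00…`; `L′(E,1) = 10.06845093…`,
`L(E^D,1) = 0.74258479…`, `ĥ(x) = 4.12197886…`) — engine 1 (j303974) = engine 2 (j304100; EQUAL `m = 12`, `ord₃ m = 1`, dev. ≤ 3.4e-15, checks true;
`3`-saturation witness prime [11, 12], `E(K)[3] = 0` witness prime [5, 'inert', 32]); twist `E^D` (stage C j304101): minimal model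
`[0, 0, 0, 1002984, 7330921675]`, `N_{E^D} = 214740144`, root number `+1`, `L(E^D,1) = 0.74258479… ≠ 0` ⇒ `r_an(E^D) = 0`; `#tors = 2`, `∏c = 8`,
`#Ш_an(E^D) = 4` — `3 ∤ #tors·#Ш_an(E^D)` (BSD-shape: the squeeze forces `Ш(E^D)[3] = 0`). DESCENT (lower half): engine C x11b `desc3lib` (j305968):
octic `A` disc `-11455500326662053669888`, `S = [2, 3, 2819]`, `Cl(A) = [12, [6, 2]]`, `bnfcertify(A,1) = 1`, `12` generators 3-saturated,
`dim H¹(ℚ,E[3];S) = 3`, **`dim Sel^(3)(E/ℚ) = 3`** (expected 3: MATCH), generator in `Sel`, mode `GRH(3sat)`, cert `certs/cert_405936q1.gp`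
`39fcd23320e287a1…`; engine E x10b `desc3full_e2` (j305969): `Cl = [12, [6, 2]]`, `Cl_S = [1, []]`, `12` generators, `bnfcertify = -2`,
`dim H¹ = 3`, **`dim Sel^(3)(E/ℚ) = 3`**, mode `LOWERBOUND` — TWO independent implementations, descent grade **LL** (E = equality EXACT, L = three
independent EXACTLY verified Selmer elements = the unconditional LOWER bound `dim ≥ 3`; the kit uses only `3³ ≤ #Sel`) ⇒ `27 ≤ #Sel^(3)(E/ℚ)`,
`Ш(E)[3] ≠ 0` — the lower half. Witnesses mod `3` `(ℓ,#Ẽ(𝔽_ℓ))` = `(5,4)` (`a = 2`: `X² − aX + ℓ` root-free over `𝔽₃`), `(61,60)` (`ℓ ≡ 1`,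
`a = 2 ≡ 2 (mod 3)`, `9 ∤ #Ẽ`). `|Δ| = ∏` over `[(2, 4), (3, 20), (2819, 1)]`. Kernel: minimality, onto, `3 ∣ #Ш` from `hSel`; displayed:
`hGZK hCT hKo hB`, Heegner datum (`hK hH hP hnt hI`), twist datum (`Wd hWd hrD`), `hr hq hv`, `hSel : 3³ ≤ #Sel^(3)(E/ℚ)`.
[cite: McCallumLMS1991, §1 Theorem (Kolyvagin), p. 296] [cite: SilvermanAEC2009, Thm. X.4.2(a) and Thm. X.4.14] [cite: Serre1972, §2.4 Prop. 15] [cite: Cremona2006, Table 1 (label 405936q1)] -/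
theorem bsdp_q405936q1_3 (hGZK : rank_eq_analyticRank_of_analyticRank_le_one)
    (hCT : exists_casselsTate_pairing (K := ℚ)) (W : WeierstrassCurve ℚ)
    (hW : W = ⟨0, 0, 0, 1896, -602525⟩) {N : ℕ} [NeZero N] {K : Type} [Field K] [NumberField K]
    (hKo : kolyvagin N W K) (hB : Kolyvagin1990_padicValNat_card_sha_le N W K) (hK : IsImaginaryQuadratic K)
    (hH : SatisfiesHeegnerHypothesis N K) {P : (W.baseChange K).toAffine.Point} (hP : IsHeegnerPoint N W K P)
    (hnt : ¬ IsOfFinAddOrder P) (hI : padicValNat 3 (AddSubgroup.zmultiples P).index ≤ 1)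
    (Wd : WeierstrassCurve ℚ) [Wd.IsElliptic]
    (hWd : ∃ C : VariableChange ℚ, C • W.quadraticTwist ((NumberField.discr K : ℤ) : ℚ) = Wd)
    (hrD : Wd.analyticRank ≤ 1) (hr : W.analyticRank = 1)
    {q : ℚ} (hq : shaAn W = (q : ℂ)) (hv : padicValRat 3 q = 2)
    (hSel : 3 ^ 3 ≤ Nat.card (W.selmerGroup (3 : ℤ))) : BSDp W 3 :=
  bsdp_three_of_kolyvaginIndexLeOne_of_le_card_selmer_of_irr_of_order 0 0 0 1896 (-602525)
    (Supersingular.isGloballyMinimal_of_krausCriterion₃_factored 0 0 0 1896 (-602525) [(2, 4), (3, 20), (2819, 1)] (by decide +kernel)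
      (by intro t ht; fin_cases ht <;> norm_num) (by decide +kernel))
    5 61 (by norm_num) (by norm_num) (by decide) (by decide) (by decide) (by decide) (by decide +kernel) (by decide +kernel)
    (n₁ := 4) (n₂ := 60) (by decide +kernel) (by decide +kernel) (by decide) (by decide) (by decide) (by decide)
    hGZK hCT W hW hKo hB hK hH hP hnt hI Wd hWd hrD hr hq hv hSel

end Summit.BirchSwinnertonDyer.Rank1Residual.X11b

end
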